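import Summits.MatrixMultiplication.OmegaCensus.ThreeSetLineInverseCertificate
import HarnessLib

/-!
# Dual (Farkas) certificates for the three-set line identity: `O(q²)` kernel checks per line datum

ω-census `pub-omega`, family (b3), seat pub-omega-group gen 40.  Framing: lottery ticket; floor = certified bounds/negative
ranges.  VALUE: a reusable kernel TOOL for the three-set cube cells over `A ↠ ℤ_p²` (`(4,d,e)@p²`: the remaining cells
`(4,5,14)@841`, `(4,4,20)@961`, `(4,5,16)@961`, …); NOT progress on ω.

Setting (`ThreeSetLineCertificate`, `ThreeSetLineInverseCertificate`): a cube symmetric form pushed along `φ : A ↠ ℤ_q` gives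
count vectors `W, F, G` and a hole `s` with `Σ_u M(τ,u)·G(u) + [s = τ] = K` for all `τ` (`M = lineMat3 W F`, the
circulant-plus-Hankel matrix `M(τ,u) = A(τ−u) + C(τ+u)` of `LineInv.mfun`).  The inverse certificate `noSol3Chk(Q)` of gen 39
costs `Θ(q³)` kernel steps per datum (`B·M ≡ I`).  Here the datum is refuted by DUAL VECTORS instead:

* **modular Farkas** — a modulus `m` and vectors `z` with `zᵀM ≡ 0 (mod m)`; a hole `s` is refuted by `z` when
  `zᵀb_s ≢ 0 (mod m)` (`b_s = K·𝟙 − e_s`): then `zᵀb_s = Σ_u G(u)·(zᵀM)_u ≡ 0`, contradiction.  (The empirical obstruction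
  for the killer data is non-integrality of the rational solution at a split prime of `ℚ(ζ_{3p})⁺`; `m` is that prime or a
  power of it.)
* **sign Farkas** — a pair `(z⁺, z⁻)` of `ℕ`-vectors with `z⁺ᵀM ≥ z⁻ᵀM` entrywise; a hole `s` is refuted when
  `z⁺ᵀb_s < z⁻ᵀb_s`: then `z⁺ᵀb_s = Σ_u G(u)(z⁺ᵀM)_u ≥ Σ_u G(u)(z⁻ᵀM)_u = z⁻ᵀb_s`, contradiction.  (For the rare data whose
  rational solution is integral with a negative entry — e.g. `X = {3,7,8,9}` against the killer `{0,0,1,2}` at `p = 17`.)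

`LineInv.farkasChk q K W F zs pairs` (each `z` with its own modulus `m`) computes the two symbols `A`, `C` by rotations
(`acoefR`, `ccoefR`: `O(q²)`, proved equal to `acoef`, `ccoef`), checks the dual vectors ONCE (`zᵀM` by `q` rotations: `O(q²)`) and then every hole against the list; **`LineInv.farkasChk_sound`**: if it passes, no `G : ZMod q → ℕ` and no hole
satisfy the identity (no bound on `G` is needed).  How the vectors were found (left kernel mod `m`; LP duality) is irrelevant.
`chunkChkP` checks a window of `compsLit q d` against an aligned list of PACKED certificates (one numeral per dual vector,
base `X`); `chunkChkP_sound` + `forall_mem_of_chunks` assemble the `hkill` hypothesis of `ThreeSetZpCells4Core`.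

Measured (gen 40, `(4,4,11)@529`, `q = 23`, killer `{17,19,21,22}`): certificates exist for every tested `X`-datum (one or two
modular vectors, moduli `2 … 2⁴⁴`, no sign pair needed in a sample of 160); kernel cost `0.36 s` per datum (`101` data in `37 s`)
against `1.0 s` for `noSol3ChkQ` — the list symbols (`0.09 s`) and `zᵀM` (`0.16 s`) dominate; a packed-row version (rows of `M`
by digit rotation, `zᵀM` by `sum_mul_enc`) is the next factor.  USAGE NOTE: a certificate list literal with more than ≈ 30
entries must be written as `[…] ++ […] ++ …` (pieces of ≤ 25): one long list literal elaborates to nested `let`s on which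
`decide` times out at `isDefEq`.
-/

namespace Summit.MatrixMultiplication.OmegaCensus

open Finset

namespace LineInv

/-! ## The checker (pure `ℕ`, lists) -/

/-- Rotate left by one. [folklore] -/
def rotL : List ℕ → List ℕ
  | [] => []
  | a :: l => l ++ [a]

/-- The first `n` left rotations `[l, rotL l, rotL² l, …]` (all rotations at the cost of one pass each). [folklore] -/
def rots : ℕ → List ℕ → List (List ℕ)
  | 0, _ => []
  | n + 1, l => l :: rots n (rotL l)

/-- FAST circulant symbol: `A(t) = W · rotate(F, t) + W · rotate(F, −t)` (`= acoef` for data of length `q`). [folklore] -/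
def acoefR (q : ℕ) (W F : List ℕ) : List ℕ :=
  let R := rots q F
  (List.range q).map fun t => dot W (R.getD t []) + dot W (R.getD ((q - t) % q) [])

/-- FAST Hankel symbol: `C(t) = W · rotate(reverse F, q−1−t)` (`= ccoef` for data of length `q`). [folklore] -/
def ccoefR (q : ℕ) (W F : List ℕ) : List ℕ :=
  let R := rots q F.reverse
  (List.range q).map fun t => dot W (R.getD (q - 1 - t) [])


/-- `zᵀM` for the circulant-plus-Hankel matrix with symbols `A`, `C` (`M(τ,u) = A(τ−u) + C(τ+u)`):
`(zᵀM)(u) = z · rotate(A, q−u) + z · rotate(C, u)` — `O(q)` per entry. [folklore] -/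
def zMul (q : ℕ) (A C z : List ℕ) : List ℕ :=
  (List.range q).map fun u => dot z (A.rotate (q - u)) + dot z (C.rotate u)

/-- Entrywise `≥` of two lists (truncating at the shorter). [folklore] -/
def geList : List ℕ → List ℕ → Bool
  | a :: as, b :: bs => decide (b ≤ a) && geList as bs
  | _, _ => true

/-- **The dual-certificate check** for the line data `(W, F)` over `ℤ_q` at fibre size `K`: every `(m, z) ∈ zs` has
`zᵀM ≡ 0 (mod m)`, every pair `(z⁺, z⁻) ∈ pairs` has `z⁺ᵀM ≥ z⁻ᵀM`, and every hole `s < q` is refuted by some `(m, z)`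
(`zᵀb_s ≢ 0 (mod m)`) or some pair (`z⁺ᵀb_s < z⁻ᵀb_s`); the data must have length `q` (fast symbols). [folklore] -/
def farkasChk (q K : ℕ) (W F : List ℕ) (zs : List (ℕ × List ℕ)) (pairs : List (List ℕ × List ℕ)) : Bool :=
  let A := acoefR q W F
  let C := ccoefR q W F
  decide (W.length = q) && decide (F.length = q) &&
  (zs.all fun mz => (zMul q A C mz.2).all fun v => v % mz.1 == 0) &&
  (pairs.all fun zz => geList (zMul q A C zz.1) (zMul q A C zz.2)) &&
  (List.range q).all fun s =>
    (zs.any fun mz => !(dot mz.2 (bvec q K s) % mz.1 == 0)) ||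
    (pairs.any fun zz => decide (dot zz.1 (bvec q K s) < dot zz.2 (bvec q K s)))

/-! ## List bridges -/

/-- Reading a rotation of a list of length `q`. [folklore] -/
theorem getD_rotate_of_length {L : List ℕ} {q : ℕ} (hL : L.length = q) (n i : ℕ) (hi : i < q) :
    (L.rotate n).getD i 0 = L.getD ((i + n) % q) 0 := by
  rw [List.getD_eq_getElem?_getD, List.getElem?_rotate (by rw [hL]; exact hi), hL, ← List.getD_eq_getElem?_getD]

/-- A rotation of a list of length `q` as a `map` over `range q`. [folklore] -/
theorem rotate_eq_range_map {L : List ℕ} {q : ℕ} (hL : L.length = q) (n : ℕ) :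
    L.rotate n = (List.range q).map fun i => L.getD ((i + n) % q) 0 := by
  apply List.ext_getElem
  · rw [List.length_rotate, hL, List.length_map, List.length_range]
  · intro i h1 h2
    rw [List.length_rotate, hL] at h1
    have e1 := getD_rotate_of_length hL n i h1
    rw [List.getD_eq_getElem?_getD, List.getElem?_eq_getElem (by rw [List.length_rotate, hL]; exact h1),
      Option.getD_some] at e1
    rw [e1, List.getElem_map, List.getElem_range]

/-- `geList a b = true` gives `b[u] ≤ a[u]` for every index inside both lists. [folklore] -/
theorem le_of_geList : ∀ {a b : List ℕ}, geList a b = true → ∀ u, u < a.length → u < b.length → b.getD u 0 ≤ a.getD u 0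
  | x :: as, y :: bs, h, u, hu, hv => by
    unfold geList at h
    rw [Bool.and_eq_true, decide_eq_true_eq] at h
    cases u with
    | zero => simpa using h.1
    | succ u =>
      simp only [List.getD_cons_succ]
      exact le_of_geList h.2 u (by simpa using hu) (by simpa using hv)
  | [], _, _, u, hu, _ => absurd hu (by simp)
  | _ :: _, [], _, u, _, hv => absurd hv (by simp)

/-- `rotL` is rotation by one. [folklore] -/
theorem rotL_eq_rotate (l : List ℕ) : rotL l = l.rotate 1 := by
  cases l with
  | nil => simp [rotL]
  | cons a l => simp [rotL]

/-- Entry `t < n` of `rots n l` is `l.rotate t`. [folklore] -/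
theorem rots_getD : ∀ (n : ℕ) (l : List ℕ) (t : ℕ), t < n → (rots n l).getD t [] = l.rotate t
  | 0, _, _, ht => absurd ht (Nat.not_lt_zero _)
  | n + 1, l, 0, _ => by simp [rots, List.rotate_zero]
  | n + 1, l, t + 1, ht => by
    simp only [rots, List.getD_cons_succ]
    rw [rots_getD n (rotL l) t (by omega), rotL_eq_rotate, List.rotate_rotate, Nat.add_comm]

/-- Index arithmetic for the second circulant term. [folklore] -/
theorem circ_index (q v t : ℕ) (ht : t < q) : (v + (q - t) % q) % q = (v + q - t) % q := by
  rcases Nat.eq_zero_or_pos t with rfl | hpos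
  · rw [Nat.sub_zero, Nat.mod_self, Nat.add_zero, Nat.sub_zero, Nat.add_mod_right]
  · rw [Nat.mod_eq_of_lt (by omega : q - t < q), show v + (q - t) = v + q - t by omega]

/-- Index arithmetic for the Hankel term through the reversed list. [folklore] -/
theorem hank_index (q v t : ℕ) (hv : v < q) (ht : t < q) : q - 1 - (v + (q - 1 - t)) % q = (t + q - v) % q := by
  rcases Nat.lt_or_ge t v with h | h
  · rw [show v + (q - 1 - t) = (v - 1 - t) + q by omega, Nat.add_mod_right, Nat.mod_eq_of_lt (by omega : v - 1 - t < q),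
      Nat.mod_eq_of_lt (by omega : t + q - v < q)]
    omega
  · rw [Nat.mod_eq_of_lt (by omega : v + (q - 1 - t) < q), show t + q - v = (t - v) + q by omega, Nat.add_mod_right,
      Nat.mod_eq_of_lt (by omega : t - v < q)]
    omega

/-- **The fast circulant symbol is `acoef`** (data of length `q`). [folklore] -/
theorem acoefR_eq (q : ℕ) (W F : List ℕ) (hF : F.length = q) : acoefR q W F = acoef q W F := by
  unfold acoefR acoef
  refine List.map_congr_left fun t ht => ?_
  rw [List.mem_range] at ht
  have hq : 0 < q := by omega
  rw [rots_getD q F t ht, rots_getD q F ((q - t) % q) (Nat.mod_lt _ hq), rotate_eq_range_map hF, rotate_eq_range_map hF,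
    dot_range_map, dot_range_map, sum_range_map, ← Finset.sum_add_distrib]
  refine Finset.sum_congr rfl fun v _ => ?_
  rw [Nat.add_comm v t, circ_index q v t ht, mul_add]

/-- **The fast Hankel symbol is `ccoef`** (data of length `q`). [folklore] -/
theorem ccoefR_eq (q : ℕ) (W F : List ℕ) (hW : W.length = q) (hF : F.length = q) : ccoefR q W F = ccoef q W F := by
  unfold ccoefR ccoef
  refine List.map_congr_left fun t ht => ?_
  rw [List.mem_range] at ht
  have hFr : F.reverse.length = q := by rw [List.length_reverse, hF]
  rw [rots_getD q F.reverse (q - 1 - t) (by omega), rotate_eq_range_map hFr, dot_range_map, sum_range_map]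
  -- entries of `W` beyond `q` do not occur (`W.length = q`), so both sums run over `v < q`
  refine Finset.sum_congr rfl fun v hv => ?_
  rw [Finset.mem_range] at hv
  congr 1
  have hidx : (v + (q - 1 - t)) % q < q := Nat.mod_lt _ (by omega)
  rw [List.getD_eq_getElem?_getD, List.getElem?_reverse (by rw [hF]; exact hidx), hF, ← List.getD_eq_getElem?_getD,
    hank_index q v t hv ht]

/-- The length of `zMul`. [folklore] -/
theorem length_zMul (q : ℕ) (A C z : List ℕ) : (zMul q A C z).length = q := by
  unfold zMul; simp

/-- **`zMul` computes `zᵀM`**: for `u < q`, `(zMul q A C z)(u) = Σ_{r<q} z(r)·mfun(r,u)` with `A = acoef`, `C = ccoef`.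
[folklore] -/
theorem zMul_getD (q : ℕ) (W F z : List ℕ) (u : ℕ) (hu : u < q) :
    (zMul q (acoef q W F) (ccoef q W F) z).getD u 0 = ∑ r ∈ Finset.range q, z.getD r 0 * mfun q W F r u := by
  have hA : (acoef q W F).length = q := by unfold acoef; simp
  have hC : (ccoef q W F).length = q := by unfold ccoef; simp
  unfold zMul
  rw [getD_range_map _ hu, rotate_eq_range_map hA, rotate_eq_range_map hC, dot_range_map, dot_range_map,
    ← Finset.sum_add_distrib]
  refine Finset.sum_congr rfl fun r _ => ?_
  unfold mfun
  rw [show r + (q - u) = r + q - u by omega, mul_add]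

/-! ## Soundness -/

section Sound

variable {q : ℕ} [NeZero q]

/-- The identity in pure-`ℕ` form: `Σ_{u<q} mfun(r,u)·G(u) = b_s(r)` for `r < q` (`b_s = bvec q K s.val`). [folklore] -/
theorem sys_of_identity {K : ℕ} {W F : List ℕ} (G : ZMod q → ℕ) (s : ZMod q)
    (hid : ∀ τ : ZMod q, (∑ u : ZMod q, lineMat3 (vecFn W) (vecFn F) τ u * G u) + (if s = τ then 1 else 0) = K)
    (r : ℕ) (hr : r < q) :
    ∑ u ∈ Finset.range q, mfun q W F r u * G (u : ZMod q) = (bvec q K s.val).getD r 0 := by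
  have h0 := hid (r : ZMod q)
  rw [sum_lineMat3_eq, ZMod.val_natCast, Nat.mod_eq_of_lt hr] at h0
  unfold bvec
  rw [getD_range_map _ hr]
  have hiff : (s = (r : ZMod q)) ↔ r = s.val := by
    constructor
    · intro e; rw [e, ZMod.val_natCast, Nat.mod_eq_of_lt hr]
    · intro e; rw [e, ZMod.natCast_zmod_val]
  by_cases hrs : r = s.val
  · rw [if_pos (hiff.2 hrs)] at h0; rw [if_pos hrs]; omega
  · rw [if_neg (fun e => hrs (hiff.1 e))] at h0; rw [if_neg hrs]; omega

/-- **Duality**: for any `z`, `zᵀb_s = Σ_u G(u)·(zᵀM)(u)` under the identity. [folklore] -/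
theorem dot_bvec_eq {K : ℕ} {W F : List ℕ} (G : ZMod q → ℕ) (s : ZMod q)
    (hid : ∀ τ : ZMod q, (∑ u : ZMod q, lineMat3 (vecFn W) (vecFn F) τ u * G u) + (if s = τ then 1 else 0) = K)
    (z : List ℕ) :
    dot z (bvec q K s.val) = ∑ u ∈ Finset.range q, G (u : ZMod q) * (zMul q (acoef q W F) (ccoef q W F) z).getD u 0 := by
  unfold bvec
  rw [dot_range_map]
  have e1 : ∑ r ∈ Finset.range q, z.getD r 0 * (if r = s.val then K - 1 else K) =
      ∑ r ∈ Finset.range q, z.getD r 0 * ∑ u ∈ Finset.range q, mfun q W F r u * G (u : ZMod q) := by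
    refine Finset.sum_congr rfl fun r hr => ?_
    rw [sys_of_identity G s hid r (Finset.mem_range.1 hr)]
    unfold bvec
    rw [getD_range_map _ (Finset.mem_range.1 hr)]
  rw [e1, Finset.sum_congr rfl fun r _ => Finset.mul_sum (Finset.range q) _ _, Finset.sum_comm]
  refine Finset.sum_congr rfl fun u hu => ?_
  rw [zMul_getD q W F z u (Finset.mem_range.1 hu), Finset.mul_sum]
  exact Finset.sum_congr rfl fun r _ => by ring

/-- **Soundness of the dual certificates.**  If `farkasChk q m K W F zs pairs` passes, then no `G : ZMod q → ℕ` and no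
hole `s` satisfy the three-set line identity `Σ_u M(τ,u)·G(u) + [s = τ] = K` for the list data `W, F`. [folklore] -/
theorem farkasChk_sound {K : ℕ} {W F : List ℕ} {zs : List (ℕ × List ℕ)} {pairs : List (List ℕ × List ℕ)}
    (h : farkasChk q K W F zs pairs = true) (G : ZMod q → ℕ) (s : ZMod q)
    (hid : ∀ τ : ZMod q, (∑ u : ZMod q, lineMat3 (vecFn W) (vecFn F) τ u * G u) + (if s = τ then 1 else 0) = K) :
    False := by
  unfold farkasChk at h
  simp only [Bool.and_eq_true, List.all_eq_true, List.mem_range, beq_iff_eq, Bool.or_eq_true, List.any_eq_true,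
    Bool.not_eq_true', beq_eq_false_iff_ne, ne_eq, decide_eq_true_eq] at h
  obtain ⟨⟨⟨⟨hWl, hFl⟩, hzs⟩, hpairs⟩, hholes⟩ := h
  rw [acoefR_eq q W F hFl, ccoefR_eq q W F hWl hFl] at hzs hpairs
  set A := acoef q W F with hA
  set C := ccoef q W F with hC
  rcases hholes s.val (ZMod.val_lt s) with ⟨mz, hz, hne⟩ | ⟨zz, hzz, hlt⟩
  · -- modular Farkas
    apply hne
    rw [dot_bvec_eq G s hid mz.2, Finset.sum_nat_mod, Finset.sum_eq_zero, Nat.zero_mod]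
    intro u hu
    have hul : u < (zMul q A C mz.2).length := by rw [length_zMul]; exact Finset.mem_range.1 hu
    have hmem : (zMul q A C mz.2).getD u 0 ∈ zMul q A C mz.2 := by
      rw [List.getD_eq_getElem?_getD, List.getElem?_eq_getElem hul, Option.getD_some]; exact List.getElem_mem hul
    have h0 : (zMul q A C mz.2).getD u 0 % mz.1 = 0 := hzs mz hz _ hmem
    rw [Nat.mul_mod, h0, mul_zero, Nat.zero_mod]
  · -- sign Farkas
    have hge := hpairs zz hzz
    have h1 : dot zz.2 (bvec q K s.val) ≤ dot zz.1 (bvec q K s.val) := by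
      rw [dot_bvec_eq G s hid zz.1, dot_bvec_eq G s hid zz.2]
      refine Finset.sum_le_sum fun u hu => Nat.mul_le_mul_left _ ?_
      exact le_of_geList hge u (by rw [length_zMul]; exact Finset.mem_range.1 hu)
        (by rw [length_zMul]; exact Finset.mem_range.1 hu)
    omega

/-- Soundness in the shape used by the cell files (`hkill` of `ThreeSetZpCells4Core`, with the redundant bound on `G`).
[folklore] -/
theorem farkasChk_sound' {K e : ℕ} {W F : List ℕ} {zs : List (ℕ × List ℕ)} {pairs : List (List ℕ × List ℕ)}
    (h : farkasChk q K W F zs pairs = true) (G : ZMod q → ℕ) (s : ZMod q) (_hG : ∀ u, G u ≤ e)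
    (hid : ∀ τ : ZMod q, (∑ u : ZMod q, lineMat3 (vecFn W) (vecFn F) τ u * G u) + (if s = τ then 1 else 0) = K) :
    False :=
  farkasChk_sound h G s hid

end Sound

/-! ## Chunks: a list of `X`-data against an aligned list of certificates -/

/-- Check a list of `X`-data `Fs` against an aligned list of certificates `cs` (one per datum, same order). [folklore] -/
def chunkChk (q K : ℕ) (W : List ℕ) (Fs : List (List ℕ))
    (cs : List (List (ℕ × List ℕ) × List (List ℕ × List ℕ))) : Bool :=
  decide (Fs.length ≤ cs.length) && (List.zipWith (fun F c => farkasChk q K W F c.1 c.2) Fs cs).all id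

section Chunk

variable {q : ℕ} [NeZero q]

/-- **Soundness of a certified chunk**: every `X`-datum in `Fs` is refuted (in the semantic shape of `hkill`,
`ThreeSetZpCells4Core`; the bound on `G` is not used). [folklore] -/
theorem chunkChk_sound {K e : ℕ} {W : List ℕ} {Fs : List (List ℕ)}
    {cs : List (List (ℕ × List ℕ) × List (List ℕ × List ℕ))} (h : chunkChk q K W Fs cs = true) :
    ∀ F ∈ Fs, ∀ (G : ZMod q → ℕ) (s : ZMod q), (∀ u, G u ≤ e) →
      ¬ ∀ τ : ZMod q, (∑ u : ZMod q, lineMat3 (vecFn W) (vecFn F) τ u * G u) + (if s = τ then 1 else 0) = K := by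
  unfold chunkChk at h
  rw [Bool.and_eq_true, decide_eq_true_eq, List.all_eq_true] at h
  obtain ⟨hlen, hall⟩ := h
  intro F hF G s _ hid
  obtain ⟨i, hi, rfl⟩ := List.getElem_of_mem hF
  have hic : i < cs.length := lt_of_lt_of_le hi hlen
  have hz : (List.zipWith (fun F c => farkasChk q K W F c.1 c.2) Fs cs)[i]'(by
      rw [List.length_zipWith]; exact lt_min hi hic) = farkasChk q K W Fs[i] (cs[i]).1 (cs[i]).2 :=
    List.getElem_zipWith
  have hmem := List.getElem_mem (l := List.zipWith (fun F c => farkasChk q K W F c.1 c.2) Fs cs)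
    (n := i) (by rw [List.length_zipWith]; exact lt_min hi hic)
  have htrue := hall _ hmem
  rw [hz] at htrue
  exact farkasChk_sound (id htrue) G s hid

/-- From chunks to the whole list: if every window `(L.drop (C·i)).take C`, `i < M`, is refuted and `L.length ≤ C·M`,
then every element of `L` is refuted. [folklore] -/
theorem forall_mem_of_chunks {α : Type*} (L : List α) (P : α → Prop) (C M : ℕ) (hCM : L.length ≤ C * M)
    (h : ∀ i, i < M → ∀ a ∈ (L.drop (C * i)).take C, P a) : ∀ a ∈ L, P a := by
  intro a ha
  obtain ⟨n, hn, rfl⟩ := List.getElem_of_mem ha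
  have hC : 0 < C := by
    rcases Nat.eq_zero_or_pos C with h0 | h0
    · rw [h0, zero_mul] at hCM; omega
    · exact h0
  refine h (n / C) ?_ _ ?_
  · by_contra hM
    rw [not_lt] at hM
    have : C * M ≤ C * (n / C) := Nat.mul_le_mul_left C hM
    have h2 : C * (n / C) ≤ n := Nat.mul_div_le n C
    omega
  · rw [List.mem_take_iff_getElem]
    refine ⟨n % C, ?_, ?_⟩
    · rw [List.length_drop]
      have h1 : n % C < C := Nat.mod_lt n hC
      have h2 : C * (n / C) + n % C = n := Nat.div_add_mod n C
      exact lt_min h1 (by omega)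
    · rw [List.getElem_drop]
      congr 1
      exact (Nat.div_add_mod n C)

end Chunk

/-! ## Packed certificates (one numeral per dual vector: base-`X` digits) -/

/-- Base-`X` digits `0 … q-1` of `n` (a dual vector packed as `Σ_j z(j)·X^j`). [folklore] -/
def unpackVec (q X n : ℕ) : List ℕ := (List.range q).map fun j => n / X ^ j % X

/-- `farkasChk` on packed dual vectors. [folklore] -/
def farkasChkP (q K X : ℕ) (W F : List ℕ) (zs : List (ℕ × ℕ)) (pairs : List (ℕ × ℕ)) : Bool :=
  farkasChk q K W F (zs.map fun mz => (mz.1, unpackVec q X mz.2))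
    (pairs.map fun zz => (unpackVec q X zz.1, unpackVec q X zz.2))

/-- A chunk of `X`-data against an aligned list of PACKED certificates. [folklore] -/
def chunkChkP (q K X : ℕ) (W : List ℕ) (Fs : List (List ℕ)) (cs : List (List (ℕ × ℕ) × List (ℕ × ℕ))) : Bool :=
  decide (Fs.length ≤ cs.length) && (List.zipWith (fun F c => farkasChkP q K X W F c.1 c.2) Fs cs).all id

section Packed

variable {q : ℕ} [NeZero q]

/-- Soundness of the packed check (the decoding is irrelevant: any decoded vectors are dual vectors). [folklore] -/
theorem farkasChkP_sound {K X : ℕ} {W F : List ℕ} {zs : List (ℕ × ℕ)} {pairs : List (ℕ × ℕ)}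
    (h : farkasChkP q K X W F zs pairs = true) (G : ZMod q → ℕ) (s : ZMod q)
    (hid : ∀ τ : ZMod q, (∑ u : ZMod q, lineMat3 (vecFn W) (vecFn F) τ u * G u) + (if s = τ then 1 else 0) = K) :
    False :=
  farkasChk_sound h G s hid

/-- **Soundness of a packed certified chunk** (semantic shape of `hkill`, `ThreeSetZpCells4Core`). [folklore] -/
theorem chunkChkP_sound {K X e : ℕ} {W : List ℕ} {Fs : List (List ℕ)} {cs : List (List (ℕ × ℕ) × List (ℕ × ℕ))}
    (h : chunkChkP q K X W Fs cs = true) :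
    ∀ F ∈ Fs, ∀ (G : ZMod q → ℕ) (s : ZMod q), (∀ u, G u ≤ e) →
      ¬ ∀ τ : ZMod q, (∑ u : ZMod q, lineMat3 (vecFn W) (vecFn F) τ u * G u) + (if s = τ then 1 else 0) = K := by
  unfold chunkChkP at h
  rw [Bool.and_eq_true, decide_eq_true_eq, List.all_eq_true] at h
  obtain ⟨hlen, hall⟩ := h
  intro F hF G s _ hid
  obtain ⟨i, hi, rfl⟩ := List.getElem_of_mem hF
  have hic : i < cs.length := lt_of_lt_of_le hi hlen
  have hz : (List.zipWith (fun F c => farkasChkP q K X W F c.1 c.2) Fs cs)[i]'(by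
      rw [List.length_zipWith]; exact lt_min hi hic) = farkasChkP q K X W Fs[i] (cs[i]).1 (cs[i]).2 :=
    List.getElem_zipWith
  have hmem := List.getElem_mem (l := List.zipWith (fun F c => farkasChkP q K X W F c.1 c.2) Fs cs)
    (n := i) (by rw [List.length_zipWith]; exact lt_min hi hic)
  have htrue := hall _ hmem
  rw [hz] at htrue
  exact farkasChkP_sound (id htrue) G s hid

end Packed

end LineInv

end Summit.MatrixMultiplication.OmegaCensus
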